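import Literature.MathematicalPhysics.QuantumFieldTheory.Balaban1983to89.B7Prop2Rec
import Literature.MathematicalPhysics.QuantumFieldTheory.Balaban1983to89.B7Prop9General

/-!
# `Balaban1983to89.B7StairLoopSmallnessRec` — [Balaban1985Averaging] pp. 24–25 («|V₀(Γ_{c,x}) − 1| < |Γ_{c,x}|·dLα₀») FOR THE STAIR FAMILIES `G(y, x)` OF [Balaban1987RG1] (0.3):
# two staircases with the same end points carry loop variables `V(Γ^σ_{y,x})·V(Γ^τ_{y,x})⁻¹` within `2|x − y|₁²·α` of `1` under (44) — the SMALLNESS INPUT of the radial→averaged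
# axial-gauge transport (`g_sr`), generic and on the RECORD tower (0.4) at every level

statement-level skeleton of published theorems with citation tags; proofs where landed; nothing here is a claim about the Yang–Mills mass gap

CITATION HEADER (lean-in-tree rule).  Cell `pub-ymgap` (HUMAN RULING D-0062), «N05-REC» road ∕ plan g93 A3⁵ «ρ3 φ-form», item (3) «`g_sr` TRANSPORT — GO on the COMMON CORE» (plan ■ word
2026-08-29T20:02Z): the analytic input every branch (φ-b defect `ψ`, (ii) Landau-restoring correction, even a sym twin) needs is the smallness of the loop variables between two
staircases of [I] (0.3)'s family `G(y, x)` — this file, in RECORD letters; the torus-side closeness of the Federbush mean to a family member is `FederbushMean.federbushSU_dist1_le`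
(already in the tree), the radial tower gauge is `B8Eq115GaugeFixingRec.tgZ ∕ localGaugeZ`.  Pen dag-n05-e g41.  [3] = [Balaban1985Averaging] (8)–(11) pp. 18–19, (44)–(45) p. 24,
p. 25 (the displays before (47)), (52)–(53) p. 26; [I] = [Balaban1987RG1] (0.3)–(0.4) pp. 252–253, (0.11) p. 253.  `--kind proof --supports stmt-QuantumFields-20541` (K0⁷;
count-neutral; no definition).
REUSED BY NAME: `B7Prop1Explicit.{hol, gaugeAct, axialFn, hol_gaugeAct, axial_bond_bound, axialFn_mem, hol_mem, norm_units_inv_conj_sub_one_le, U1, l1}`,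
`B7Prop9General.norm_hol_sub_one_le_of_l1` (linear growth of axial bond deviations integrates along words), `T4Continuum.stairWord` with `BlockAveragingZd.{disp_stairWord,
length_stairWord, offZ, l1_offZ_le, avgIterZ}`, `B7Prop2Explicit.{pdev, le_pdev}`, `B7Prop2Rec.{AvgClosedZ, avgIterZ_mem}`.

WHAT IS PROVED (sorry-free).  §1 (any `U1`-valued `V` on `ℤᵈ` with (44) `sup_p |V(∂p) − 1| ≤ α`): `norm_hol_stairWord_axial_sub_one_le` — in the axial gauge at `y` every staircase
`Γ^σ_{y, y+n}` has `|V₀(Γ^σ) − 1| ≤ |n|₁²·α`; ★ `norm_stairLoop_sub_one_le` — `|V(Γ^σ_{y,y+n})·V(Γ^τ_{y,y+n})⁻¹ − 1| ≤ 2|n|₁²·α` for ANY two orderings `σ, τ` (gauge invariance of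
the closed loop `Γ^σ ∪ −Γ^τ` at its base point + §1); `norm_stairLoop_sub_one_le_pdev` (the same with `α := pdev V`).  §2 (the RECORD tower): ★★ `norm_stairLoop_avgIterZ_sub_one_le` —
for the record averages `Ūʲ = avgIterZ L V j`, `j ≤ k`, of a `G`-valued `V` (`G` `AvgClosedZ`, the (52)-regime of [3] Prop. 2 = the hypotheses of `B7Prop2Rec.avgIterZ_mem`), at every
CENTRED block `L•z + [−s, s]ᵈ` and every block point `x = L•z + offZ r`: `|Ūʲ(Γ^σ_{L•z,x})·Ūʲ(Γ^τ_{L•z,x})⁻¹ − 1| ≤ 2(d·s)²·pdev Ūʲ` — the per-level, per-block smallness of [I]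
(0.11)'s stair family around its radial member, to be fed to (53) (`B7Prop2Rec.ineq53_explicitZ`: `pdev Ūʲ < α₀(LʲL⁻ᵏ)² + …`) by the consumer.
HONEST SCOPE.  Elementary holonomy bookkeeping ([3] p. 25's argument along staircases); NO new estimate of Bałaban's beyond that display; the transport gauge `g_sr` itself, its
tower telescoping and the block exp-mean-log defect `ψ` are NOT here (their currency — record `ℤᵈ` vs torus — waits for the plan's (Q-ψ) branch); `HThm4Rec*` CONDITIONAL; N05
DISCHARGED OF RECORD since R467 (this is count-neutral record-level work), N07 NOT discharged; counts unmoved (typed 28∕28 · discharged 8∕28); one finite 𝕋⁴ programme at fixed ε,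
`G = SU(2)` of record — nothing continuum ∕ ℝ⁴ ∕ OS ∕ mass gap ∕ Clay.  No `def`, no `instance`, no `notation`, no `sorry`.
-/

set_option autoImplicit false

noncomputable section

open scoped BigOperators

namespace Literature.MathematicalPhysics.QuantumFieldTheory.Balaban1983to89.B7StairLoopSmallnessRec

open B7Prop1Explicit hiding Site
open B7Prop1Explicit renaming Site → SiteZ
open T4Continuum (stairWord)
open BlockAveragingZd (offZ avgIterZ disp_stairWord length_stairWord l1_offZ_le)
open B7Prop2Explicit (pdev le_pdev pdev_nonneg)
open B7Prop2Rec (AvgClosedZ C0Z avgIterZ_mem)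
open B7Prop2Explicit (c2')
open B7Prop9General (norm_hol_sub_one_le_of_l1)

variable {d : ℕ}
variable {𝔸 : Type*} [NormedRing 𝔸] [NormOneClass 𝔸] [NormedAlgebra ℂ 𝔸] [CompleteSpace 𝔸]

/-! ## §1  Two staircases with the same end points: the loop variable is within `2|n|₁²·α` of `1` -/

section Generic

omit [NormedAlgebra ℂ 𝔸] [CompleteSpace 𝔸] in
/-- **p. 25 along a staircase, in the axial gauge at its base**: under (44) `|V(∂p) − 1| ≤ α` (all unit plaquettes), for the axial gauge `V₀ = V^{v}` at `y` (`v = axialFn V y`),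
every staircase `Γ^σ_{y, y+n}` of [I] (0.3) has `|V₀(Γ^σ) − 1| ≤ |n|₁²·α` — the axial bond bound `|V₀(b) − 1| ≤ |b₋ − y|₁·α` (`B7Prop1Explicit.axial_bond_bound`) integrated along the
`|n|₁` bonds of the word (`B7Prop9General.norm_hol_sub_one_le_of_l1`). [cite: Balaban1985Averaging, p.25 (displays before (47)), (44) p.24; Balaban1987RG1, (0.3) p.252] -/
theorem norm_hol_stairWord_axial_sub_one_le {V : SiteZ d → Fin d → 𝔸ˣ} (hV : ∀ x κ, V x κ ∈ U1 𝔸) {α : ℝ} (hα : 0 ≤ α)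
    (h44 : ∀ (x : SiteZ d) (κ μ : Fin d), κ ≠ μ → ‖((hol V x (plaqWord κ μ) : 𝔸ˣ) : 𝔸) - 1‖ ≤ α)
    (y : SiteZ d) (σ : Equiv.Perm (Fin d)) (n : SiteZ d) :
    ‖((hol (gaugeAct (axialFn V y) V) y (stairWord σ n) : 𝔸ˣ) : 𝔸) - 1‖ ≤ ((l1 n : ℕ) : ℝ) ^ 2 * α := by
  have hV₀ : ∀ x κ, gaugeAct (axialFn V y) V x κ ∈ U1 𝔸 := gaugeAct_mem hV (axialFn_mem hV y)
  have hb : ∀ (x : SiteZ d) (κ : Fin d), ‖((gaugeAct (axialFn V y) V x κ : 𝔸ˣ) : 𝔸) - 1‖ ≤ l1 (x - y) * α :=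
    fun x κ => axial_bond_bound V hV y h44 hα x κ
  have h := norm_hol_sub_one_le_of_l1 hV₀ y hα hb (stairWord σ n) y
  rw [length_stairWord, sub_self] at h
  refine h.trans (le_of_eq ?_)
  simp [l1, sq]

omit [NormedAlgebra ℂ 𝔸] [CompleteSpace 𝔸] in
/-- ★ **THE STAIR-FAMILY LOOP VARIABLES ARE SMALL**: under (44) `|V(∂p) − 1| ≤ α`, for any two orderings `σ, τ` of [I] (0.3)'s staircases from `y` to `y + n`,
`|V(Γ^σ_{y,y+n})·V(Γ^τ_{y,y+n})⁻¹ − 1| ≤ 2|n|₁²·α` — the closed loop `Γ^σ ∪ −Γ^τ` is conjugated by `v(y)` under the axial gauge `v` at `y` ((8)∕(11) p. 18–19), and in that gauge both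
staircase transporters are within `|n|₁²·α` of `1` (§1).  This is the pairwise closeness of [I] (0.11)'s family `{U(Γ)}_{Γ ∈ G(y,x)}` that a group average `M` needs ((0.5)–(0.7),
Federbush (0.10)). [cite: Balaban1985Averaging, (8) p.18, (11) p.19, p.25 (displays before (47)); Balaban1987RG1, (0.3) p.252, (0.11) p.253] -/
theorem norm_stairLoop_sub_one_le {V : SiteZ d → Fin d → 𝔸ˣ} (hV : ∀ x κ, V x κ ∈ U1 𝔸) {α : ℝ} (hα : 0 ≤ α)
    (h44 : ∀ (x : SiteZ d) (κ μ : Fin d), κ ≠ μ → ‖((hol V x (plaqWord κ μ) : 𝔸ˣ) : 𝔸) - 1‖ ≤ α)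
    (y : SiteZ d) (σ τ : Equiv.Perm (Fin d)) (n : SiteZ d) :
    ‖((hol V y (stairWord σ n) * (hol V y (stairWord τ n))⁻¹ : 𝔸ˣ) : 𝔸) - 1‖ ≤ 2 * ((l1 n : ℕ) : ℝ) ^ 2 * α := by
  set v : SiteZ d → 𝔸ˣ := axialFn V y with hv
  set V₀ : SiteZ d → Fin d → 𝔸ˣ := gaugeAct v V with hV₀def
  have hvU : ∀ x, v x ∈ U1 𝔸 := fun x => axialFn_mem hV y x
  have hV₀ : ∀ x κ, V₀ x κ ∈ U1 𝔸 := gaugeAct_mem hV hvU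
  -- the two staircase transporters in the axial gauge
  set A : 𝔸ˣ := hol V₀ y (stairWord σ n) with hA
  set B : 𝔸ˣ := hol V₀ y (stairWord τ n) with hB
  have hAn : ‖(A : 𝔸) - 1‖ ≤ ((l1 n : ℕ) : ℝ) ^ 2 * α := norm_hol_stairWord_axial_sub_one_le hV hα h44 y σ n
  have hBn : ‖(B : 𝔸) - 1‖ ≤ ((l1 n : ℕ) : ℝ) ^ 2 * α := norm_hol_stairWord_axial_sub_one_le hV hα h44 y τ n
  have hBU : B ∈ U1 𝔸 := hol_mem hV₀ y _
  -- gauge covariance of open paths with equal end points: `V(Γ^σ)V(Γ^τ)⁻¹ = v(y)⁻¹·(A·B⁻¹)·v(y)`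
  have hdσ : disp (stairWord σ n) = n := disp_stairWord σ n
  have hdτ : disp (stairWord τ n) = n := disp_stairWord τ n
  have hσ' : hol V y (stairWord σ n) = (v y)⁻¹ * A * v (y + n) := by
    have h := hol_gaugeAct v V y (stairWord σ n)
    rw [hdσ] at h
    rw [hA, hV₀def, h]; group
  have hτ' : hol V y (stairWord τ n) = (v y)⁻¹ * B * v (y + n) := by
    have h := hol_gaugeAct v V y (stairWord τ n)
    rw [hdτ] at h
    rw [hB, hV₀def, h]; group
  have hloop : hol V y (stairWord σ n) * (hol V y (stairWord τ n))⁻¹ = (v y)⁻¹ * (A * B⁻¹) * v y := by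
    rw [hσ', hτ']; group
  rw [hloop, Units.val_mul, Units.val_mul]
  refine (norm_units_inv_conj_sub_one_le (hvU y) _).trans ?_
  -- `‖A·B⁻¹ − 1‖ ≤ ‖A − 1‖ + ‖B − 1‖` for `B ∈ U1`
  have hsplit : ((A * B⁻¹ : 𝔸ˣ) : 𝔸) - 1 = ((A : 𝔸) - 1) * ((B⁻¹ : 𝔸ˣ) : 𝔸) + ((B⁻¹ : 𝔸ˣ) : 𝔸) * (1 - (B : 𝔸)) := by
    rw [Units.val_mul, sub_mul, one_mul, mul_sub, mul_one, Units.inv_mul]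
    abel
  rw [hsplit]
  calc ‖((A : 𝔸) - 1) * ((B⁻¹ : 𝔸ˣ) : 𝔸) + ((B⁻¹ : 𝔸ˣ) : 𝔸) * (1 - (B : 𝔸))‖
      ≤ ‖((A : 𝔸) - 1) * ((B⁻¹ : 𝔸ˣ) : 𝔸)‖ + ‖((B⁻¹ : 𝔸ˣ) : 𝔸) * (1 - (B : 𝔸))‖ := norm_add_le _ _
    _ ≤ ‖(A : 𝔸) - 1‖ * ‖((B⁻¹ : 𝔸ˣ) : 𝔸)‖ + ‖((B⁻¹ : 𝔸ˣ) : 𝔸)‖ * ‖1 - (B : 𝔸)‖ := add_le_add (norm_mul_le _ _) (norm_mul_le _ _)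
    _ ≤ ‖(A : 𝔸) - 1‖ * 1 + 1 * ‖1 - (B : 𝔸)‖ := by
        gcongr
        · exact hBU.2
        · exact hBU.2
    _ = ‖(A : 𝔸) - 1‖ + ‖(B : 𝔸) - 1‖ := by rw [mul_one, one_mul, norm_sub_rev (1 : 𝔸) (B : 𝔸)]
    _ ≤ ((l1 n : ℕ) : ℝ) ^ 2 * α + ((l1 n : ℕ) : ℝ) ^ 2 * α := add_le_add hAn hBn
    _ = 2 * ((l1 n : ℕ) : ℝ) ^ 2 * α := by ring

omit [NormedAlgebra ℂ 𝔸] [CompleteSpace 𝔸] in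
/-- **The same with `α := sup_p |V(∂p) − 1|`** (`B7Prop2Explicit.pdev`, the (44)∕(52) quantity). [cite: Balaban1985Averaging, (44) p.24, (52) p.26; Balaban1987RG1, (0.3) p.252] -/
theorem norm_stairLoop_sub_one_le_pdev {V : SiteZ d → Fin d → 𝔸ˣ} (hV : ∀ x κ, V x κ ∈ U1 𝔸)
    (y : SiteZ d) (σ τ : Equiv.Perm (Fin d)) (n : SiteZ d) :
    ‖((hol V y (stairWord σ n) * (hol V y (stairWord τ n))⁻¹ : 𝔸ˣ) : 𝔸) - 1‖ ≤ 2 * ((l1 n : ℕ) : ℝ) ^ 2 * pdev V :=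
  norm_stairLoop_sub_one_le hV (pdev_nonneg V) (fun x κ μ _ => le_pdev hV x κ μ) y σ τ n

end Generic

/-! ## §2  On the RECORD tower (0.4): every level, every centred block -/

section RecordTower

/-- ★★ **THE STAIR FAMILY OF EVERY RECORD AVERAGE IS SMALL AROUND ITS RADIAL MEMBER, AT EVERY CENTRED BLOCK**: in the (52)-regime of [3] Prop. 2 for the record averaging
(`B7Prop2Rec.avgIterZ_mem`'s hypotheses: `G` `AvgClosedZ`, `V` `G`-valued, `C₀α₀ ≤ ⅓`, `2α₀ ≤ c₂′`, `sup_p|V(∂p) − 1| < α₀L^{−2k}`), for every `j ≤ k`, every centred block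
`L•z + [−s, s]ᵈ` (`L = 2s+1`), every block point `x = L•z + offZ r` and any two orderings `σ, τ`: `|Ūʲ(Γ^σ_{L•z,x})·Ūʲ(Γ^τ_{L•z,x})⁻¹ − 1| ≤ 2(d·s)²·sup_p|Ūʲ(∂p) − 1|`
(`Ūʲ = avgIterZ L V j` is `G ≤ U1`-valued by `avgIterZ_mem`; `|offZ r|₁ ≤ d·s`).  Combined with (53) (`B7Prop2Rec.ineq53_explicitZ`) this is the per-level input of the
radial→averaged axial-gauge transport. [cite: Balaban1985Averaging, p.25 (displays before (47)), (52)–(53) p.26; Balaban1987RG1, (0.3)–(0.4) pp.252–253, (0.11) p.253] -/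
theorem norm_stairLoop_avgIterZ_sub_one_le {L s : ℕ} (hLs : L = 2 * s + 1) (hL : 2 ≤ L) {G : Subgroup 𝔸ˣ} (hG : AvgClosedZ d L G) (k : ℕ)
    (V : SiteZ d → Fin d → 𝔸ˣ) (hV : ∀ x κ, V x κ ∈ G) {α₀ : ℝ} (hα : 0 < α₀)
    (hα3 : C0Z d * α₀ ≤ 1 / 3) (hα2 : 2 * α₀ ≤ c2' d L)
    (h52 : pdev V < α₀ * (((L : ℝ) ^ k)⁻¹) ^ 2)
    {j : ℕ} (hj : j ≤ k) (z : SiteZ d) (r : Fin d → Fin L) (σ τ : Equiv.Perm (Fin d)) :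
    ‖((hol (avgIterZ L V j) ((L : ℤ) • z) (stairWord σ (offZ L r)) *
        (hol (avgIterZ L V j) ((L : ℤ) • z) (stairWord τ (offZ L r)))⁻¹ : 𝔸ˣ) : 𝔸) - 1‖
      ≤ 2 * ((d * s : ℕ) : ℝ) ^ 2 * pdev (avgIterZ L V j) := by
  have hmem : ∀ x κ, avgIterZ L V j x κ ∈ U1 𝔸 := fun x κ =>
    hG.le_U1 (avgIterZ_mem L hL hG k V hV hα hα3 hα2 h52 j hj x κ)
  refine (norm_stairLoop_sub_one_le_pdev hmem _ σ τ _).trans ?_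
  have hl : ((l1 (offZ L r) : ℕ) : ℝ) ≤ ((d * s : ℕ) : ℝ) := by exact_mod_cast l1_offZ_le hLs r
  have hp : 0 ≤ pdev (avgIterZ L V j) := pdev_nonneg _
  have hl0 : (0 : ℝ) ≤ ((l1 (offZ L r) : ℕ) : ℝ) := by positivity
  gcongr

end RecordTower

end Literature.MathematicalPhysics.QuantumFieldTheory.Balaban1983to89.B7StairLoopSmallnessRec
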